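import Summits.Ventures.Crystal3D.StickySpheres.TriangleFrame
import HarnessLib

/-!
# Expanded forms of the frame inequalities (for the machine-generated certificates)

Venture `Crystal3D` (cell `pub-crystal3d`, seat p2). The generated pattern refutations (`Open8*.lean`, `Nine22*.lean`,
`BipyrCap.lean`) state every hypothesis as an EXPANDED polynomial and close their steps with `linear_combination`,
which treats the definition `frameQ` as an atom; these restatements of `frameQ_nonneg` with the quadratic form written
out are what the generated one-line derivations of the linear consequences (`1 + ⟪s, t⟫ ≥ 0`, `1 ± ⟪s, d⟫ ≥ 0` for unit
`s, t, d`) invoke.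

HONEST FRAMING: trivial corollaries, infrastructure only; nothing is claimed here.
-/

noncomputable section

namespace Summit.Ventures.Crystal3D

/-- `frameQ` written out is non-negative. [folklore] -/
theorem frameQ_nonneg' (a b c : ℝ) : 0 ≤ a ^ 2 + b ^ 2 + a * b + 3 / 2 * c ^ 2 := by
  have h := frameQ_nonneg a b c
  unfold frameQ at h
  exact h

/-- Cauchy–Schwarz in the frame, expanded: for `frameQ`-unit vectors the bilinear form is `≥ -1`. [folklore] -/
theorem frameB_ge_neg_one {a b c a' b' c' : ℝ} (h : a ^ 2 + b ^ 2 + a * b + 3 / 2 * c ^ 2 = 1)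
    (h' : a' ^ 2 + b' ^ 2 + a' * b' + 3 / 2 * c' ^ 2 = 1) :
    -1 ≤ a * a' + b * b' + (a * b' + b * a') / 2 + 3 / 2 * (c * c') := by
  linear_combination (1 / 2 : ℝ) * frameQ_nonneg' (a + a') (b + b') (c + c') + (1 / 2 : ℝ) * h
    + (1 / 2 : ℝ) * h'

/-- Cauchy–Schwarz in the frame, expanded: for `frameQ`-unit vectors the bilinear form is `≤ 1`. [folklore] -/
theorem frameB_le_one {a b c a' b' c' : ℝ} (h : a ^ 2 + b ^ 2 + a * b + 3 / 2 * c ^ 2 = 1)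
    (h' : a' ^ 2 + b' ^ 2 + a' * b' + 3 / 2 * c' ^ 2 = 1) :
    a * a' + b * b' + (a * b' + b * a') / 2 + 3 / 2 * (c * c') ≤ 1 := by
  linear_combination (1 / 2 : ℝ) * frameQ_nonneg' (a - a') (b - b') (c - c') + (1 / 2 : ℝ) * h
    + (1 / 2 : ℝ) * h'

end Summit.Ventures.Crystal3D

end
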